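import Literature.Topology.FourManifolds.SurfaceGroupNielsenCoreCasePPbAux
import HarnessLib

/-!
# Nielsen's theorem, pillar CORE: a double point at the portals of two symbols, mixed sides (βα)

Topic `Literature/Topology/FourManifolds`.  The case of the case analysis of a double point
`a < b` on the closed path of a potential-minimal configuration (Zieschang–Vogt–Coldewey, LNM 835,
proof of Thm. 5.3.2 with Lemma 5.3.4, in the minimal-counterexample recasting) in which `a` is
interior to the kernel of an occurrence `k` (between its slots `sa - 1 | sa`, value word `V`,
`|V| = n`), `b` is interior to the kernel of an occurrence `k'` of a DIFFERENT symbol (slots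
`sb - 1 | sb`, value word `V'`, `|V'| = n'`), the partner `k̄` is OUTSIDE the subloop and the
partner `k̄'` is INSIDE — the mirror image of `SurfaceGroupNielsenCoreCasePPio.lean`.

The crossing edges of the fixation are the formal edges at the post-cut slots `(k, q)`,
`sa ≤ q` (inside, facing the outside `k̄`) and at the post-cut slots `(k', q')`, `sb ≤ q'`
(outside, facing the inside `k̄'`); the far ends `(k̄, n - 1 - q)`, `(k̄', n' - 1 - q')` are
head slots, so the levels are `n - 1 - q` resp. `n' - 1 - q'`.  The parity principle gives
`n - sa = n' - sb` and puts the two head ends of each level `e < n - sa` on one component, so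
they carry the same letter: `V[n - 1 - e] = V'[n' - 1 - e]`, i.e. `V[sa, n) = V'[sb, n')`.
Reading the double point as a vertex of both occurrence paths,
`E_{k+1} = E_k · V = v · V[sa, n) = v · V'[sb, n') = E_{k'+1}` (`v` the double point): the block
of occurrences `k + 1, …, k'` has trivial value; it is non-empty, proper and symbol-closed (`k̄'`
is inside, `k̄` outside, other symbols by Claim (A)) — a decomposition, contradicting
indecomposability.

## References

* H. Zieschang, E. Vogt, H.-D. Coldewey, *Surfaces and Planar Discontinuous Groups*, LNM 835
  (1980), proof of Thm. 5.3.2 and Lemma 5.3.4. [ZieschangVogtColdewey1980]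
-/

noncomputable section

namespace Literature.Topology.FourManifolds

open Literature.GroupTheory.CombinatorialGroupTheory CycFactors List

namespace SurfaceGroup

namespace Config

variable {g : ℕ} {φ : surfaceGen g → SurfaceGroup g}

section PPoi

variable (hg : 2 ≤ g) (hK : RelatorKilled φ) (hI : Indecomposable φ) (hM : MarkedNontrivial φ)
  (κ : Config φ) (hmin : κ.IsMin) (d : κ.DoublePoint)
include hg hK hI hM hmin

omit hK in
/-- **No double point at the portals of two symbols with `k̄` outside and `k̄'` inside.**
[cite: ZieschangVogtColdewey1980, proof of Thm. 5.3.2 and Lemma 5.3.4] -/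
theorem false_of_doublePoint_PP_oi {k k' : ℕ} (hPa : κ.PortalAt d.a k) (hPb : κ.PortalAt d.b k')
    (_hkk' : k' ≠ κ.bar k) (hk : κ.Outside d.a d.b (κ.bar k))
    (hk' : κ.Inside d.a d.b (κ.bar k')) : False := by
  have hg1 : 1 ≤ g := by omega
  let _i : Inhabited (surfaceGen g) := ⟨(⟨0, by omega⟩, false)⟩
  have hN := κ.cycNielsen_U hg1 hI hM hmin
  have hU := κ.U_ne_nil hg1
  have hbar := κ.isPairing_bar
  have hab := d.lt
  have hbℓ := d.lt_length
  have hkw : k < κ.w.length := κ.lt_length_of_portalAt hPa (hab.trans hbℓ).le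
  have hk'w : k' < κ.w.length := κ.lt_length_of_portalAt hPb hbℓ.le
  have hkU : k < κ.U.length := by rw [length_U]; exact hkw
  have hk'U : k' < κ.U.length := by rw [length_U]; exact hk'w
  have hne : k ≠ k' := by
    rintro rfl
    exact κ.not_outside_of_inside hg1 hI hM hmin hk' hk
  have hsep := κ.ppb_sep hPa hPb hne
  have hlt : k < k' := κ.ppb_lt_of_portalAt hab hPa hPb hne
  have hP2 := DoublePoint.kpos_mem_iff_of_chainEnd κ hg1 hI hM hmin d
  -- numerical data of `k` and `k'`
  set n := (fac κ.U k).length with hn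
  set n' := (fac κ.U k').length with hn'
  have hnb : (fac κ.U (κ.bar k)).length = n := hbar.length_fac_bar hkU
  have hnb' : (fac κ.U (κ.bar k')).length = n' := hbar.length_fac_bar hk'U
  set sa := κ.slotAt k d.a with hsa
  set sb := κ.slotAt k' d.b with hsb
  obtain ⟨hsa1, hsa2⟩ := κ.slotAt_bounds_of_portalAt hg1 hI hM hmin hPa
  obtain ⟨hsb1, hsb2⟩ := κ.slotAt_bounds_of_portalAt hg1 hI hM hmin hPb
  -- the side function and (P2) in side form
  obtain ⟨s, hs_def⟩ : ∃ s : ℕ × ℕ → Bool, s = fun σ => decide (κ.SideIn d.a d.b σ) :=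
    ⟨_, rfl⟩
  have hs : ∀ σ, s σ = decide (κ.SideIn d.a d.b σ) := fun σ => by rw [hs_def]
  have hP2s : ∀ τ, IsKernelSlot κ.U τ → s τ = s (chainEnd κ.U κ.bar τ) := fun τ hτ => by
    rw [hs, hs]
    exact κ.decide_sideIn_eq_decide_sideIn_chainEnd hg1 hI hM hmin hab hsep hP2 hτ
  -- the crossing formal edges of the two portal symbols
  have hXk : ∀ q, IsCrossing s (fedge κ.U κ.bar (k, q)) ↔ sa ≤ q := fun q => by
    rw [isCrossing_fedge, hs, hs, ← κ.fcross_iff_decide_ne]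
    exact κ.fcross_iff_of_portalAt_left_of_outside hg1 hI hM hmin hab hsep hPa hk q
  have hXk' : ∀ q', IsCrossing s (fedge κ.U κ.bar (k', q')) ↔ sb ≤ q' := fun q' => by
    rw [isCrossing_fedge, hs, hs, ← κ.fcross_iff_decide_ne]
    exact κ.fcross_iff_of_portalAt_right_of_inside hsep hPb hk' q'
  -- their far ends are head slots, so their levels are the depths
  have hHk : ∀ q, sa ≤ q → q < n → IsHeadSlot κ.U (fpartner κ.U κ.bar (k, q)) :=
    fun q hq hqn =>
      κ.isHeadSlot_of_portalAt_left_of_outside hg1 hI hM hmin hab hsep hP2 hkw hPa hk hq hqn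
  have hHk' : ∀ q', sb ≤ q' → q' < n' → IsHeadSlot κ.U (fpartner κ.U κ.bar (k', q')) :=
    fun q' hq' hqn' =>
      κ.isHeadSlot_of_portalAt_right_of_inside hg1 hI hM hmin hP2 hk'w hPb hk' hq' hqn'
  have hLk : ∀ q, sa ≤ q → q < n → level κ.U (k, q) = n - 1 - q := by
    intro q hq hqn
    have hσ : IsSlot κ.U (k, q) := ⟨hkU, by dsimp only; omega⟩
    have h1 := (hHk q hq hqn).level_eq hN
    have h2 := hbar.level_fpartner hσ
    dsimp only [fpartner] at h1 h2
    omega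
  have hLk' : ∀ q', sb ≤ q' → q' < n' → level κ.U (k', q') = n' - 1 - q' := by
    intro q' hq' hqn'
    have hσ : IsSlot κ.U (k', q') := ⟨hk'U, by dsimp only; omega⟩
    have h1 := (hHk' q' hq' hqn').level_eq hN
    have h2 := hbar.level_fpartner hσ
    dsimp only [fpartner] at h1 h2
    omega
  -- the crossing edges all of whose ends have level `e`
  have hlev : ∀ e ε', IsEdge κ.U κ.bar ε' → IsCrossing s ε' →
      (∀ ρ' ∈ ε'.2, level κ.U ρ' = e) →
      (∃ q, sa ≤ q ∧ q < n ∧ n - 1 - q = e ∧ ε' = fedge κ.U κ.bar (k, q)) ∨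
        (∃ q', sb ≤ q' ∧ q' < n' ∧ n' - 1 - q' = e ∧ ε' = fedge κ.U κ.bar (k', q')) := by
    intro e ε' hε' hc' hl
    rcases κ.ppb_crossing_edge_cases hg1 hI hM hmin hab hbℓ hP2 hPa hPb hsep hs hε' hc' with
      ⟨q, hqn, rfl⟩ | ⟨q', hqn', rfl⟩
    · have hq : sa ≤ q := (hXk q).1 hc'
      have := hl (k, q) (mem_fedge.2 (Or.inl rfl))
      rw [hLk q hq hqn] at this
      exact Or.inl ⟨q, hq, hqn, this, rfl⟩
    · have hq' : sb ≤ q' := (hXk' q').1 hc'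
      have := hl (k', q') (mem_fedge.2 (Or.inl rfl))
      rw [hLk' q' hq' hqn'] at this
      exact Or.inr ⟨q', hq', hqn', this, rfl⟩
  -- PARITY, first consequence: the post-cut parts have the same length, `n - sa = n' - sb`
  have hlen : n - sa = n' - sb := by
    by_contra hne'
    rcases Nat.lt_or_gt_of_ne hne' with h | h
    · -- the edge at `(k', n' - 1 - (n - sa))` is alone at level `n - sa`
      have hσ : IsSlot κ.U (k', n' - 1 - (n - sa)) := ⟨hk'U, by dsimp only; omega⟩
      have hl0 := hLk' (n' - 1 - (n - sa)) (by omega) (by omega)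
      refine false_of_crossing_alone_level hN hU hbar hP2s (isEdge_fedge hσ)
        ((hXk' _).2 (by omega)) ⟨(k', n' - 1 - (n - sa)), mem_fedge.2 (Or.inl rfl), by omega⟩
        fun ε' hε' hc' hl => ?_
      rcases hlev _ ε' hε' hc' hl with ⟨q, h1, h2, h3, rfl⟩ | ⟨q', h1, h2, h3, rfl⟩
      · exfalso
        omega
      · have e : q' = n' - 1 - (n - sa) := by omega
        rw [e]
    · -- the edge at `(k, n - 1 - (n' - sb))` is alone at level `n' - sb`
      have hσ : IsSlot κ.U (k, n - 1 - (n' - sb)) := ⟨hkU, by dsimp only; omega⟩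
      have hl0 := hLk (n - 1 - (n' - sb)) (by omega) (by omega)
      refine false_of_crossing_alone_level hN hU hbar hP2s (isEdge_fedge hσ)
        ((hXk _).2 (by omega)) ⟨(k, n - 1 - (n' - sb)), mem_fedge.2 (Or.inl rfl), by omega⟩
        fun ε' hε' hc' hl => ?_
      rcases hlev _ ε' hε' hc' hl with ⟨q, h1, h2, h3, rfl⟩ | ⟨q', h1, h2, h3, rfl⟩
      · have e : q = n - 1 - (n' - sb) := by omega
        rw [e]
      · exfalso
        omega
  -- PARITY, second consequence: the post-cut parts of `V` and `V'` agree letter by letter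
  have hletter : ∀ i (hi : i < n - sa),
      (fac κ.U k)[sa + i]'(by omega) = (fac κ.U k')[sb + i]'(by omega) := by
    intro i hi
    have hσ : IsSlot κ.U (k, sa + i) := ⟨hkU, by dsimp only; omega⟩
    have hσ' : IsSlot κ.U (k', sb + i) := ⟨hk'U, by dsimp only; omega⟩
    have hpair := sameComp_of_crossing_pair_level hN hU hbar hP2s
      (ε₂ := fedge κ.U κ.bar (k', sb + i)) (e := n - 1 - (sa + i)) (isEdge_fedge hσ)
      ((hXk _).2 (by omega))
      ⟨(k, sa + i), mem_fedge.2 (Or.inl rfl), hLk _ (by omega) (by omega)⟩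
      (fun ε' hε' hc' hl => by
        rcases hlev _ ε' hε' hc' hl with ⟨q, h1, h2, h3, rfl⟩ | ⟨q', h1, h2, h3, rfl⟩
        · have e : q = sa + i := by omega
          rw [e]
          exact Or.inl rfl
        · have e : q' = sb + i := by omega
          rw [e]
          exact Or.inr rfl)
    have hsc : SameComp κ.U κ.bar (fpartner κ.U κ.bar (k, sa + i))
        (fpartner κ.U κ.bar (k', sb + i)) :=
      hpair _ (mem_fedge.2 (Or.inr rfl)) _ (mem_fedge.2 (Or.inr rfl))
    have hty : slotType κ.U κ.bar (fpartner κ.U κ.bar (k', sb + i)) =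
        slotType κ.U κ.bar (fpartner κ.U κ.bar (k, sa + i)) := by
      rw [(hHk _ (by omega) (by omega)).slotType_eq hN hU,
        (hHk' _ (by omega) (by omega)).slotType_eq hN hU]
    have key := hsc.slotLetter_eq_of_slotType_eq hN hU hbar hty
    rw [hbar.slotLetter_fpartner hσ, hbar.slotLetter_fpartner hσ', hσ.slotLetter_eq,
      hσ'.slotLetter_eq] at key
    exact (ppb_letter_eq_of_inv_eq key).symm
  have hdrop : (fac κ.U k).drop sa = (fac κ.U k').drop sb := by
    apply List.ext_getElem
    · simp only [List.length_drop]
      omega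
    · intro i h1 h2
      rw [List.getElem_drop, List.getElem_drop]
      exact hletter i (by simp only [List.length_drop] at h1; omega)
  -- the double point as a vertex of both occurrence paths: `E_{k+1} = E_{k'+1}`
  have hva : κ.absv d.a = κ.occStart k * proj g (FreeGroup.mk ((fac κ.U k).take sa)) := by
    have e : kpos κ.U (k, sa) = d.a := κ.kpos_slotAt hPa.1.le
    rw [← e]
    exact κ.absv_kpos hN hkw (by omega) (by omega)
  have hvb : κ.absv d.b = κ.occStart k' * proj g (FreeGroup.mk ((fac κ.U k').take sb)) := by
    have e : kpos κ.U (k', sb) = d.b := κ.kpos_slotAt hPb.1.le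
    rw [← e]
    exact κ.absv_kpos hN hk'w (by omega) (by omega)
  have hvab : κ.absv d.a = κ.absv d.b := (κ.absv_eq_absv_iff _ _).2 d.pv_eq
  have hocc1 :
      κ.occStart (k + 1) = κ.absv d.a * proj g (FreeGroup.mk ((fac κ.U k).drop sa)) := by
    rw [hva, mul_assoc, ← map_mul, FreeGroup.mul_mk, List.take_append_drop,
      κ.occStart_mul_proj_fac hkw]
  have hocc1' :
      κ.occStart (k' + 1) = κ.absv d.b * proj g (FreeGroup.mk ((fac κ.U k').drop sb)) := by
    rw [hvb, mul_assoc, ← map_mul, FreeGroup.mul_mk, List.take_append_drop,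
      κ.occStart_mul_proj_fac hk'w]
  have hocc : κ.occStart (k + 1) = κ.occStart (k' + 1) := by
    rw [hocc1, hocc1', hvab, hdrop]
  -- the block `k + 1, …, k'` is non-empty, proper, symbol-closed and has trivial value
  have hbk' : k < κ.bar k' ∧ κ.bar k' < k' := κ.ppb_btwn_of_inside hPa hPb hk'
  have hnbk := κ.ppb_not_btwn_of_outside hg1 hI hM hmin hPa hPb hk
  refine false_of_occStart_eq hI κ (j₁ := k + 1) (j₂ := k' + 1) (by omega) (by omega) (by omega)
    (κ.blockClosed_of_bar fun j hj h1 h2 => ?_) hocc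
  rcases Nat.lt_or_ge j k' with h2 | h2
  · by_cases hjb : j = κ.bar k'
    · rw [hjb, κ.bar_bar hk'w]
      exact ⟨by omega, by omega⟩
    · have hjb' : j ≠ κ.bar k := fun h => hnbk (by subst h; exact ⟨by omega, h2⟩)
      have h3 := κ.ppb_bar_btwn hg1 hI hM hmin hP2 hPa hPb hj (by omega) h2 hjb' hjb
      exact ⟨h3.1, by omega⟩
  · obtain rfl : j = k' := by omega
    exact ⟨hbk'.1, by omega⟩

end PPoi

end Config

end SurfaceGroup

end Literature.Topology.FourManifolds

end
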